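import Literature.Computability.Cryptography.GSAEstimate2016
import Literature.Analysis.ValidatedNumerics.IntervalLogArctan
import HarnessLib

/-!
# Sieve-cost CONVENTIONS of the core-SVP methodology, as printed: the exponents `0.292` / `0.265` / `0.2075`,
# their exact forms `log₂√(3/2)`, `log₂√(13/9)`, `log₂√(4/3)`, the 'dimensions for free' count and the
# 'progressivity overhead' of the Kyber round-3 refined estimate

Topic `Computability/Cryptography`; extends `namespace Literature.Computability.Cryptography.BKZModel`
(`GSAEstimate2016.lean`: `rootHermiteLimit`, `KyberPrimalSuccess`, …). Like that file, everything here is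
a DEFINITION (a printed constant or formula) plus exact bookkeeping lemmas; nothing asserts that any
algorithm attains these costs. Sources (verbatim):

* Kyber spec v3.02 §5.1.1 p. 26: "improving the heuristic complexity from `(4/3)^{b+o(b)} ≈ 2^{0.415b+o(b)}`
  down to `√(3/2)^{b+o(b)} ≈ 2^{0.292b+o(b)}` using locality-sensitive hashing (LSH) techniques [63, 17]. […]
  Grover's quantum search algorithm, bringing the complexity down to `2^{0.265b+o(b)}` […] For our first
  analysis, we will use `2^{0.292b}` as the classical and `2^{0.265b}` and the quantum cost estimate of both
  the primal and dual attacks with block size (dimension) `b`."; §5.1.3 p. 26: "Because the sieving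
  algorithms provides `2^{0.2075b}` vectors". [AvanziEtAl2021KyberSpec]
* Dilithium spec v3.1 App. C.1 p. 33: "The best known classical SVP solver [BDGL16b] runs in time `≈ 2^{c_C·b}`
  with `c_C = log₂√(3/2) ≈ 0.292`. The best known quantum SVP solver [Laa15, Sec. 14.2.10] runs in time
  `≈ 2^{c_Q·b}` with `c_Q = log₂√(13/9) ≈ 0.265`. One may hope to improve these run-times, but going below
  `≈ 2^{c_P·b}` with `c_P = log₂√(4/3) ≈ 0.2075` would require a theoretical breakthrough." [BaiEtAl2021DilithiumSpec]
* Kyber spec §5.2.1 p. 27: "the progressivity overhead `C = 1/(1 − 2^{−.292}) = 5.46`, that is the limit of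
  ratio between `Σ_{i≤b} 2^{.292i+o(i)}` and `2^{.292b+o(b)}` as `b` grows."; p. 28: "According to [40], the
  number of 'dimensions for free' is `d4f = b·ln(4/3)/ln(b/(2πe))`" and "`G = (1025 − 413)·C²·2^{137.4} = 2^{151.5}`";
  Ducas 2018 §1 p. 2: "Heuristic arguments lead to a concrete prediction of `d ≈ n·ln(4/3)/ln(n/2πe)`."
  [AvanziEtAl2021KyberSpec] [Ducas2018]

## Contents (namespace `Literature.Computability.Cryptography.BKZModel`)

* `sieveExpClassical = 0.292`, `sieveExpQuantum = 0.265`, `sieveExpVectors = 0.2075` (the ROUNDED constants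
  the specs compute with); `coreSVPLog2 c β = c·β` (log₂ of the core-SVP cost `2^{cβ}`).
* `cC = log₂√(3/2)`, `cQ = log₂√(13/9)`, `cP = log₂√(4/3)` (the EXACT forms) with closed forms in `Real.log`
  and kernel-checked brackets `cC ∈ (0.2924, 0.2925)`, `cQ ∈ (0.2652, 0.2653)`, `cP ∈ (0.2075, 0.2076)` —
  so `|cC − 0.292| < 5·10⁻⁴` etc.: the rounded and exact conventions are different numbers.
* `d4f β`, `progressivityC` (with `5.45 < C < 5.47`, the printed `5.46`), `refinedGates n b g = (n − b)·C²·g`.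

Brackets are proved with the tree's interval engine `NumericsMP.MI` (`logNat2`, `exp`) by `decide +kernel`.
-/

noncomputable section

open Literature.Analysis.ValidatedNumerics.NumericsMP

namespace Literature.Computability.Cryptography

namespace BKZModel

/-! ### The rounded exponents used by the scripts -/

/-- Classical sieve exponent `0.292` ("we will use `2^{0.292b}` as the classical … cost estimate").
[cite: AvanziEtAl2021KyberSpec, §5.1.1 p. 26] -/
def sieveExpClassical : ℝ := 0.292

/-- Quantum sieve exponent `0.265`. [cite: AvanziEtAl2021KyberSpec, §5.1.1 p. 26] -/
def sieveExpQuantum : ℝ := 0.265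

/-- Exponent of the number of vectors output by a sieve, `2^{0.2075b}`. [cite: AvanziEtAl2021KyberSpec, §5.1.3 p. 26] -/
def sieveExpVectors : ℝ := 0.2075

/-- log₂ of the core-SVP cost `2^{c·β}` of one SVP call in block size `β` under exponent convention `c`.
[cite: AvanziEtAl2021KyberSpec, §5.1.1 p. 26] -/
def coreSVPLog2 (c : ℝ) (β : ℕ) : ℝ := c * β

/-- Unfolding lemma. [cite: AvanziEtAl2021KyberSpec, §5.1.1 p. 26] -/
theorem coreSVPLog2_classical (β : ℕ) : coreSVPLog2 sieveExpClassical β = 0.292 * β := rfl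

/-! ### The exact exponents `c_C = log₂√(3/2)`, `c_Q = log₂√(13/9)`, `c_P = log₂√(4/3)` -/

/-- `c_C = log₂ √(3/2)`. [cite: BaiEtAl2021DilithiumSpec, App. C.1 p. 33] -/
def cC : ℝ := Real.logb 2 (Real.sqrt (3 / 2))

/-- `c_Q = log₂ √(13/9)`. [cite: BaiEtAl2021DilithiumSpec, App. C.1 p. 33] -/
def cQ : ℝ := Real.logb 2 (Real.sqrt (13 / 9))

/-- `c_P = log₂ √(4/3)` ("Paranoid"). [cite: BaiEtAl2021DilithiumSpec, App. C.1 p. 33] -/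
def cP : ℝ := Real.logb 2 (Real.sqrt (4 / 3))

/-- `log₂ √(p/r) = (log p − log r)/(2 log 2)` for positive naturals. [folklore] -/
private theorem logb_sqrt_div (p r : ℕ) (hp : 0 < p) (hr : 0 < r) :
    Real.logb 2 (Real.sqrt ((p : ℝ) / r)) = (Real.log p - Real.log r) / (2 * Real.log 2) := by
  have hpr : (0 : ℝ) < p := by exact_mod_cast hp
  have hrr : (0 : ℝ) < r := by exact_mod_cast hr
  rw [Real.logb, Real.log_sqrt (by positivity), Real.log_div hpr.ne' hrr.ne']
  have h2 : Real.log 2 ≠ 0 := (Real.log_pos (by norm_num)).ne'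
  field_simp

/-- `c_C = (log 3 − log 2)/(2 log 2)`. [cite: BaiEtAl2021DilithiumSpec, App. C.1 p. 33] -/
theorem cC_eq : cC = (Real.log 3 - Real.log 2) / (2 * Real.log 2) := by
  have h := logb_sqrt_div 3 2 (by norm_num) (by norm_num)
  push_cast at h
  exact h

/-- `c_Q = (log 13 − log 9)/(2 log 2)`. [cite: BaiEtAl2021DilithiumSpec, App. C.1 p. 33] -/
theorem cQ_eq : cQ = (Real.log 13 - Real.log 9) / (2 * Real.log 2) := by
  have h := logb_sqrt_div 13 9 (by norm_num) (by norm_num)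
  push_cast at h
  exact h

/-- `c_P = (log 4 − log 3)/(2 log 2)`. [cite: BaiEtAl2021DilithiumSpec, App. C.1 p. 33] -/
theorem cP_eq : cP = (Real.log 4 - Real.log 3) / (2 * Real.log 2) := by
  have h := logb_sqrt_div 4 3 (by norm_num) (by norm_num)
  push_cast at h
  exact h

/-- Kernel checker: the linear form `a·log p + c·log r + e·log 2` has a positive enclosure lower end
(scale `S`, `K` series terms). [folklore] -/
def logLinPosCheck (S K : ℕ) (p r : ℕ) (a c e : ℤ) : Bool :=
  match MI.logNat2 S K p, MI.logNat2 S K r, MI.logNat2 S K 2 with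
  | some Lp, some Lr, some L2 => decide (0 < (((Lp.mulInt a).add (Lr.mulInt c)).add (L2.mulInt e)).lo)
  | _, _, _ => false

/-- Soundness of `logLinPosCheck`. [folklore] -/
private theorem logLin_pos_of_check {S K p r : ℕ} {a c e : ℤ} (hS : 0 < S)
    (h : logLinPosCheck S K p r a c e = true) :
    0 < (a : ℝ) * Real.log p + c * Real.log r + e * Real.log 2 := by
  unfold logLinPosCheck at h
  split at h
  · rename_i Lp Lr L2 hLp hLr hL2
    have hm := MI.mem_add (MI.mem_add (MI.mem_mulInt (MI.mem_logNat2 hS hLp) a)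
      (MI.mem_mulInt (MI.mem_logNat2 hS hLr) c)) (MI.mem_mulInt (MI.mem_logNat2 hS hL2) e)
    have hlo : (0 : ℝ) < (((Lp.mulInt a).add (Lr.mulInt c)).add (L2.mulInt e)).lo := by
      exact_mod_cast (of_decide_eq_true h)
    have hSr : (0 : ℝ) < S := by exact_mod_cast hS
    have := hm.1
    push_cast at this
    nlinarith
  · simp at h

/-- A ratio `(log p − log r)/(2 log 2)` lies in `(lo/den, hi/den)` if two log-linear forms are positive. [folklore] -/
private theorem ratio_mem_of_checks {p r : ℕ} {lo hi : ℤ} {den : ℕ} (hden : 0 < den)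
    (h1 : 0 < (den : ℝ) * Real.log p + (-(den : ℤ) : ℝ) * Real.log r + ((-2 * lo : ℤ) : ℝ) * Real.log 2)
    (h2 : 0 < ((-(den : ℤ) : ℤ) : ℝ) * Real.log p + (den : ℝ) * Real.log r + ((2 * hi : ℤ) : ℝ) * Real.log 2) :
    (lo : ℝ) / den < (Real.log p - Real.log r) / (2 * Real.log 2) ∧
      (Real.log p - Real.log r) / (2 * Real.log 2) < (hi : ℝ) / den := by
  have hl2 : 0 < Real.log 2 := Real.log_pos (by norm_num)
  have hdr : (0 : ℝ) < den := by exact_mod_cast hden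
  push_cast at h1 h2
  constructor
  · rw [div_lt_div_iff₀ hdr (by positivity)]; nlinarith
  · rw [div_lt_div_iff₀ (by positivity) hdr]; nlinarith

/-- Kernel evaluation of the six log-linear sign conditions (scale `2^64`). [folklore] -/
private theorem exponent_checks :
    logLinPosCheck (2 ^ 64) 70 3 2 10000 (-10000) (-2 * 2924) = true ∧
    logLinPosCheck (2 ^ 64) 70 3 2 (-10000) 10000 (2 * 2925) = true ∧
    logLinPosCheck (2 ^ 64) 70 13 9 10000 (-10000) (-2 * 2652) = true ∧
    logLinPosCheck (2 ^ 64) 70 13 9 (-10000) 10000 (2 * 2653) = true ∧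
    logLinPosCheck (2 ^ 64) 70 4 3 10000 (-10000) (-2 * 2075) = true ∧
    logLinPosCheck (2 ^ 64) 70 4 3 (-10000) 10000 (2 * 2076) = true := by
  refine ⟨?_, ?_, ?_, ?_, ?_, ?_⟩ <;> decide +kernel

/-- **`0.2924 < c_C < 0.2925`** (so `c_C ≠ 0.292`: `|c_C − 0.292| ∈ (4·10⁻⁴, 5·10⁻⁴)`). [cite: BaiEtAl2021DilithiumSpec, App. C.1 p. 33 (c_C ≈ 0.292)] -/
theorem cC_bounds : (0.2924 : ℝ) < cC ∧ cC < 0.2925 := by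
  have hS : 0 < 2 ^ 64 := by norm_num
  have h := ratio_mem_of_checks (p := 3) (r := 2) (lo := 2924) (hi := 2925) (den := 10000) (by norm_num)
    (by have := logLin_pos_of_check hS exponent_checks.1; push_cast at this ⊢; linarith)
    (by have := logLin_pos_of_check hS exponent_checks.2.1; push_cast at this ⊢; linarith)
  rw [cC_eq]
  push_cast at h
  constructor <;> linarith [h.1, h.2]

/-- **`0.2652 < c_Q < 0.2653`**. [cite: BaiEtAl2021DilithiumSpec, App. C.1 p. 33 (c_Q ≈ 0.265)] -/
theorem cQ_bounds : (0.2652 : ℝ) < cQ ∧ cQ < 0.2653 := by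
  have hS : 0 < 2 ^ 64 := by norm_num
  have h := ratio_mem_of_checks (p := 13) (r := 9) (lo := 2652) (hi := 2653) (den := 10000) (by norm_num)
    (by have := logLin_pos_of_check hS exponent_checks.2.2.1; push_cast at this ⊢; linarith)
    (by have := logLin_pos_of_check hS exponent_checks.2.2.2.1; push_cast at this ⊢; linarith)
  rw [cQ_eq]
  push_cast at h
  constructor <;> linarith [h.1, h.2]

/-- **`0.2075 < c_P < 0.2076`**. [cite: BaiEtAl2021DilithiumSpec, App. C.1 p. 33 (c_P ≈ 0.2075)] -/
theorem cP_bounds : (0.2075 : ℝ) < cP ∧ cP < 0.2076 := by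
  have hS : 0 < 2 ^ 64 := by norm_num
  have h := ratio_mem_of_checks (p := 4) (r := 3) (lo := 2075) (hi := 2076) (den := 10000) (by norm_num)
    (by have := logLin_pos_of_check hS exponent_checks.2.2.2.2.1; push_cast at this ⊢; linarith)
    (by have := logLin_pos_of_check hS exponent_checks.2.2.2.2.2; push_cast at this ⊢; linarith)
  rw [cP_eq]
  push_cast at h
  constructor <;> linarith [h.1, h.2]

/-! ### Dimensions for free, progressivity overhead, refined gate count (Kyber §5.2.1) -/

/-- `d4f(β) = β·ln(4/3)/ln(β/(2πe))`, the predicted number of 'dimensions for free'.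
[cite: Ducas2018, §1 p. 2 (d ≈ n ln(4/3)/ln(n/2πe))] [cite: AvanziEtAl2021KyberSpec, §5.2.1 p. 28] -/
def d4f (β : ℕ) : ℝ := β * Real.log (4 / 3) / Real.log (β / (2 * Real.pi * Real.exp 1))

/-- The progressivity overhead `C = 1/(1 − 2^{−0.292})` (printed value `5.46`).
[cite: AvanziEtAl2021KyberSpec, §5.2.1 p. 27] -/
def progressivityC : ℝ := 1 / (1 - (2 : ℝ) ^ (-(0.292 : ℝ)))

/-- The refined classical gate count `G = (n − b)·C²·g` of progressive BKZ to block size `b` in dimension `n`,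
`g` = gate count of one `AllPairSearch` in the sieving dimension `b − d4f(b)` (printed instance:
`(1025 − 413)·C²·2^{137.4} = 2^{151.5}`). [cite: AvanziEtAl2021KyberSpec, §5.2.1 p. 28] -/
def refinedGates (n b : ℕ) (g : ℝ) : ℝ := ((n : ℝ) - b) * progressivityC ^ 2 * g

/-- Kernel checker: `2^{−0.292} = exp(−(292/1000)·log 2) ∈ (lo/10⁵, hi/10⁵)`. [folklore] -/
def twoPowCheck (S K k : ℕ) (lo hi : ℤ) : Bool :=
  match MI.logNat2 S K 2 with
  | some L2 =>
    match MI.exp S K k ((L2.mulInt (-292)).divNat 1000) with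
    | some Y => decide (lo * (S : ℤ) < Y.lo * 100000 ∧ Y.hi * 100000 < hi * (S : ℤ))
    | none => false
  | none => false

/-- Soundness of `twoPowCheck`. [folklore] -/
private theorem twoPow_mem_of_check {S K k : ℕ} {lo hi : ℤ} (hS : 0 < S) (h : twoPowCheck S K k lo hi = true) :
    (lo : ℝ) / 100000 < (2 : ℝ) ^ (-(0.292 : ℝ)) ∧ (2 : ℝ) ^ (-(0.292 : ℝ)) < (hi : ℝ) / 100000 := by
  unfold twoPowCheck at h
  split at h
  · rename_i L2 hL2
    split at h
    · rename_i Y hY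
      have hx := MI.mem_divNat (MI.mem_mulInt (MI.mem_logNat2 hS hL2) (-292)) (show 0 < 1000 by norm_num)
      have hm := MI.mem_exp hS hY hx
      have e : Real.exp (Real.log ((2 : ℕ) : ℝ) * ((-292 : ℤ) : ℝ) / ((1000 : ℕ) : ℝ)) = (2 : ℝ) ^ (-(0.292 : ℝ)) := by
        rw [Real.rpow_def_of_pos (by norm_num)]
        push_cast
        congr 1
        ring
      rw [e] at hm
      have h' := of_decide_eq_true h
      have h1 : (lo : ℝ) * S < Y.lo * 100000 := by exact_mod_cast h'.1
      have h2 : (Y.hi : ℝ) * 100000 < hi * S := by exact_mod_cast h'.2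
      have hSr : (0 : ℝ) < S := by exact_mod_cast hS
      constructor
      · rw [div_lt_iff₀ (by norm_num)]; nlinarith [hm.1]
      · rw [lt_div_iff₀ (by norm_num)]; nlinarith [hm.2]
    · simp at h
  · simp at h

/-- **`5.45 < C < 5.47`** (the printed `C = 5.46`): from `2^{−0.292} ∈ (0.81652, 0.81718)`, kernel-evaluated.
[cite: AvanziEtAl2021KyberSpec, §5.2.1 p. 27 (C = 5.46)] -/
theorem progressivityC_bounds : (5.45 : ℝ) < progressivityC ∧ progressivityC < 5.47 := by
  have hS : 0 < 2 ^ 64 := by norm_num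
  have hc : twoPowCheck (2 ^ 64) 60 8 81652 81718 = true := by decide +kernel
  obtain ⟨h1, h2⟩ := twoPow_mem_of_check hS hc
  push_cast at h1 h2
  have hpos : 0 < 1 - (2 : ℝ) ^ (-(0.292 : ℝ)) := by linarith
  unfold progressivityC
  constructor
  · rw [lt_div_iff₀ hpos]; nlinarith
  · rw [div_lt_iff₀ hpos]; nlinarith

end BKZModel

end Literature.Computability.Cryptography

end
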